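import Literature.MathematicalPhysics.QuantumFieldTheory.Balaban1983to89.B2Ineq329PrismHolonomy
import Literature.MathematicalPhysics.QuantumFieldTheory.Balaban1983to89.B2Eq255Concrete

/-!
# `Balaban1983to89.B2Ineq329CovariantAveraging` — [Balaban1982Higgs2] (3.29) p. 590 FOR A REGULAR NON-ZERO VECTOR FIELD `Ã`,
file 2/4: **the covariant averaging inequality with abelian holonomy error** on the CONCRETE torus carrier — for a region
`Λ ⊂ T⁽ᵏ⁾_{Lᵏε}`, `Ω = Bᵏ(Λ) ⊂ T_ε`, any `v : T_ε → ℝ^N` and a vector field `Ã` whose one-step differences are `≤ δ` on `Ω`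
((1.21) of [B4] in lattice units),
`Σ_{⟨y,y′⟩⊂Λ} (Lᵏε)^d |(D^{Lᵏε}_{Ā⁽ᵏ⁾} Q_k(Ã)v)(⟨y,y′⟩)|² ≤ 4 Σ_{b⊂Ω} ε^d |(D^ε_Ã v)(b)|² + 8d³e²L^{2k}δ² Σ_{x∈Ω} ε^d|v(x)|²`
(`Ā⁽ᵏ⁾` the straight-bond average (II.2.55) of `Ã`, `Q_k(Ã)` the covariant block average (I.2.3)) — the bond part of [B4]'s
proof of «Proposition 3.1′ of [2]» = (3.29) in the form recorded by the lineage (exact covariant telescoping along the prisms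
of file 1, holonomy through (1.21)), re-run on the torus (`HiggsLattice` / `HiggsAveraging`)

statement-level skeleton of published theorems with citation tags; proofs where landed; nothing here is a claim about the Yang–Mills mass gap

CITATION HEADER.  T. Bałaban, *(Higgs)₂,₃ quantum fields in a finite volume. II. An upper bound*, Commun. Math. Phys.
**86** (1982) 555–594 [Balaban1982Higgs2] (cell paper B2; PDF held `paper:balaban1982-cmp86-higgs23-ii`, journal page
= PDF page + 554; p. 589–590 [PDF 35–36] READ AS IMAGES on the ×2 renders
`run/shared/lean/pub/pub-balaban/b2b-balaban-ref1/pages/1982-cmp86-higgs23-II/1982-cmp86-higgs23-II-p035-x2.png`, `-p036-x2.png`);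
T. Bałaban, *Regularity and decay of lattice Green's functions*, Commun. Math. Phys. **89** (1983) 571–597
[Balaban1983RegularityDecay] (= [B4]; `paper:balaban1983-cmp89-regularity-decay`, journal page = PDF page + 570; p. 574
[PDF 4] and §4 pp. 589–591 [PDF 19–21] read on the ×2 renders `…/1983-cmp89-regularity-decay/…-p004/p019/p020-x2.png`);
part I [Balaban1982Higgs1], Commun. Math. Phys. **85** (1982) 603–626, (1.7) p. 605, (2.1)–(2.3) p. 608; part II (2.55) p. 570.
Cell `lit-balaban` (HOME `run/shared/lean/pub/lit-balaban/`), Phase-2 proof seat **p23** gen 9 (unit `lit-balaban-p23-g9`);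
SKELETON rows **B2.Eq3.29** / **B2.Prop3.1** (owner r02, second reader r14, referee ref-4), their last residue = cell
GAPS G-pv07-1: (3.29) for a RESTRICTED (regular, non-zero) `Ã`.  The zero-field averaging inequality on this carrier is
p15's `B2Ineq329ZeroAveraging.averaging_ineq` (constant 2, no error term); [B4]'s regular-field theorem on the ℤ^{d+1}
carriers is p35's `B4Prop31Regular.form122_lattice` (regions there do not transport to torus regions that wrap).  File 1
(`B2Ineq329PrismHolonomy`, landed) supplies the prism-holonomy bound `abs_hol_le`; files 3–4 (`B2Ineq329BlockPoincare`,
`B2Ineq329RegularField`) carry the block Poincaré inequality and (3.29) itself with the Prop. 3.1 restricted clause.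
REUSED BY NAME, never restated: the typer's `HiggsLattice.{ChargeData.U, U_add, U_mem_unitary, norm_q_le, covDeriv}`,
`HiggsAveraging.{avgQk, avgQk_apply, shiftN, segSum, multiContourSum, toFinest, blockIter, blockK}`, p33's
`B2Eq255Concrete.{barA, barA_apply}` (the average `Ā⁽ᵏ⁾`), p15's `B2Ineq329ZeroAveraging.{coarse_count_le, blockK, …}`,
p17's `B2Restr216Lattice.{segSum_succ, shiftN_succ, norm_U_apply}`, file 1's `B2Ineq329PrismHolonomy.abs_hol_le`.

WHAT IS PRINTED.  [B2] p. 590 [PDF 36], verbatim: *"Now inequality (3.26) of the proposition follows from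
⟨φ′_k, Δ⁽ᵏ⁾(Bᵏ(Λ_k), Ã^η)φ′_k⟩ ≥ γ₀(Σ_{⟨x,x′⟩⊂Λ_k} |U(Ã^η(⟨x,x′⟩))φ′_k(x′) − φ′_k(x)|² + Σ_{x∈Λ_k} m²(Lᵏε)²|φ′_k(x)|²)
− O((Lᵏε)^{κ₀})|Λ_k|, (3.29) with a constant γ₀ independent of k, Λ_k and for φ′_k, Ã^η satisfying suitable restrictions.
This inequality will be proved together with the properties of the covariances (formulated in Propositions I.2.1 and
I.2.3)."*  [B4] p. 574 [PDF 4], verbatim: *"Proposition 3.1′ of [2]. Let Ω be a sum of unit blocks (i.e. Ω⁽ᵏ⁾ is an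
arbitrary subset of Zᵈ) and let A satisfies the condition |(∂^η_μA)(x)| ≤ O(1)p(e) (p(e) = a₀(1 + log e⁻¹)ᵖ), (1.21) then
there exists a positive constant γ₀ depending on d only, such that for e sufficiently small ⟨φ, Δ⁽ᵏ⁾(Ω,A)φ⟩ ≥
γ₀(Σ_{⟨x,x′⟩⊂Ω⁽ᵏ⁾}|U(A(⟨x,x′⟩))φ(x′) − φ(x)|² + m²Σ_{x∈Ω⁽ᵏ⁾}|φ(x)|²) − O(1)e^{2−α}Σ_{x∈Ω⁽ᵏ⁾}|φ(x)|² (1.22) … This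
theorem implies (3.29) of [2]."*  [B4] p. 590 [PDF 20], verbatim: *"Now it is easily seen that to prove (1.18) it is
sufficient to prove a_k|φ(x)|² + a_k|φ(x′)|² − a_k²⟨φ, Q_k(A)G_k(Δ(x,x′),A)Q_k^*(A)φ⟩ ≥ γ₀′|U(A(⟨x,x′⟩))φ(x′) − φ(x)|² −
O(1)e²p²(e)(|φ(x)|² + |φ(x′)|²), (4.7) with γ₀′ independent of k, ⟨x,x′⟩, and A. … Using the regularity condition for A,
we write A = A₀ + A′ on Δ(x,x′) with A₀ constant and A′ satisfying the bounds |A′|, |∂^η_μA′| ≤ O(1)p(e). We expand the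
expression on the left hand side of (4.7) with respect to A′ using (I.3.15), (I.3.44), and we separate terms of first
order in e. Using Lemma 2.1 the remaining terms can be easily estimated by O(e²p²(e))(|φ(x)|² + |φ(x′)|²)."*
[B1] p. 605: *"U(A(⟨x,x′⟩)) = exp(ie(Lᵏε)A(⟨x,x′⟩)q)"* (abelian: `U(a)U(b) = U(a+b)`); [B2] (2.55) p. 570: the coarse field
`Ā⁽ᵏ⁾(⟨y,y+e_μ⟩) = L^{−k} Σ_{t<Lᵏ} Ã(⟨ŷ + tεe_μ, ŷ + (t+1)εe_μ⟩)` (straight-bond average from the block corner `ŷ`).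

DICTIONARY (print ↦ Lean; everything on the typer's concrete tori `Site P j`, level `k ≤ K`).  «A regular» (1.21) ↦
`|Ã ⟨z + εe_ν, μ′⟩ − Ã ⟨z, μ′⟩| ≤ δ` at the sites `z ∈ Ω` (lattice units; the dictionary `δ ↤ ε·O(1)p(e)·(scale factors)`
with `e = e(Lᵏε)` is written in file 4); `U(A(⟨·,·⟩))` ↦ `ChargeData.U η a = exp((η·e·a)•q)`; `Q_k(Ã)v` ↦ `avgQk C Ã k v`
((I.2.3), transports along `Γ^{(k)}_{y,x}` = `multiContourSum`); the coarse bond variable ↦ `barA k Ã` with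
`U(Lᵏε, Ā⁽ᵏ⁾(c)) = U(ε, Σ_{straight path} Ã)` (`U_mesh_barA`); «we write A = A₀ + A′ … separate terms of first order»
↦ the EXACT identity `transport_identity`: `U(S)U(Γ′)v(x′) − U(Γ)v(x) = U(Γ)[(U(P)v(x′) − v(x)) + U(P)(U(hol)v(x′) − v(x′))]`
with `hol = S + Γ′ − Γ − P` the circulation around the prism of file 1, `|hol| ≤ 2dL^{2k}δ` (`abs_hol_le`), and
«O(e²p²(e))(|φ|²)» ↦ `‖U(hol)w − w‖ ≤ ε|e||hol|·‖w‖` (`norm_U_apply_sub_le`, mean value inequality for `t ↦ exp(tX)`)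
squared and summed: the coefficient `8d²e²L^{2k}δ²` per coarse bond, `8d³e²L^{2k}δ²` per region (each coarse site ends `d`
coarse bonds); the straight part `U(P)v(x′) − v(x)` ↦ telescoping through the `Lᵏ` fine covariant derivatives along
`[x, x′]` (`norm_U_segSum_sub_le_sum`), Cauchy–Schwarz, and the fine-bond multiplicity `≤ Lᵏ` (p15's counting
`coarse_count_le`: each fine bond serves at most two coarse bonds).

WHAT THIS MODULE PROVES (kernel-checked, 0 `sorry`, standard axioms; theorems only, no new definition, no `Prop` fact).
 §6 transports: `opNorm_U_le_one`, **`norm_U_sub_one_le`** (`‖U(η,a) − 1‖ ≤ |ηea|`), `norm_U_apply_sub_le`, `U_apply_U`,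
    **`U_mesh_barA`** (coarse transport = straight-path fine transport), **`norm_U_segSum_sub_le_sum`** (covariant
    telescoping along a straight path).
 §7 one coarse bond: `transport_identity` (exact prism decomposition), **`covDeriv_avgQk_sq_le`**:
    `(Lᵏε)^d|(D_{Ā}Q_k(Ã)v)(⟨y,y+e_μ⟩)|² ≤ 2Σ_{b: fine μ-bonds with block points in {y,y+e_μ}} ε^d|D_Ã v(b)|²
    + 8d²e²L^{2k}δ² Σ_{x′∈Bᵏ(y+e_μ)} ε^d|v(x′)|²`.
 §8 a region: `sum_inside_tgt_le`, `sum_blockK_sum`, **`cov_averaging_ineq`** (the display in the title).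
HONEST SCOPE.  (i) This is the bond («kinetic») input of (3.29)/(1.22) only; the mass part ((4.1)–(4.4) of [B4]), the block
Poincaré step and the assembly with p15's `termForm`/`prop31_concrete` are files 3–4.  (ii) The print expands to first
order in `A′` and bounds the remainder by Lemma 2.1; the Lean route is the lineage's exact telescoping (recorded deviation of
p35's `B4Prop31Regular`), so the error coefficient `8d³e²L^{2k}δ²` is ours — the print only asserts `O(1)e²p²(e)` after
rescaling.  (iii) Levels `k ≤ K`; constant `4 = 2·2` (two from `|a+b|² ≤ 2|a|²+2|b|²`, two from the fine-bond multiplicity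
across the two blocks), not optimised.
-/

open scoped BigOperators

namespace Literature.MathematicalPhysics.QuantumFieldTheory.Balaban1983to89.B2Ineq329CovariantAveraging

open Finset
open Literature.MathematicalPhysics.QuantumFieldTheory.Balaban1983to89.HiggsLattice
open Literature.MathematicalPhysics.QuantumFieldTheory.Balaban1983to89.HiggsAveraging
open Literature.MathematicalPhysics.QuantumFieldTheory.Balaban1983to89.B2Ineq329ZeroAveraging
open Literature.MathematicalPhysics.QuantumFieldTheory.Balaban1983to89.HiggsCovariancePos (Inside shiftEquiv sum_site_dir
  unshift_shift)
open Literature.MathematicalPhysics.QuantumFieldTheory.Balaban1983to89.B2Restr216Lattice (cornerN cornerN_zero cornerN_d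
  segSum_succ shiftN_succ toFinest_zero norm_U_apply)
open Literature.MathematicalPhysics.QuantumFieldTheory.Balaban1983to89.B2Eq255Concrete (barA barA_apply)
open Literature.MathematicalPhysics.QuantumFieldTheory.Balaban1983to89.B1Eq353SupNorm (card_blockK)
open Literature.MathematicalPhysics.QuantumFieldTheory.Balaban1983to89.B2Ineq329PrismHolonomy

variable {P : Params} {N : ℕ}

/-! ## §6 The transports: unitarity, composition, `U − 1` small, the coarse transport `U(Ā)` = the straight-path transport -/

section Transport

/-- The operator norm of a transport is at most one (it is unitary, p. 605). [cite: Balaban1982Higgs1, (1.7) p.605] -/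
theorem opNorm_U_le_one (C : ChargeData N) (η a : ℝ) : ‖C.U η a‖ ≤ 1 := by
  refine ContinuousLinearMap.opNorm_le_bound _ zero_le_one fun w => ?_
  rw [ContinuousLinearMap.norm_map_of_mem_unitary (C.U_mem_unitary η a) w, one_mul]

/-- **`‖U(η,a) − 1‖ ≤ |ηea|`**: `t ↦ exp(t·ηea·q)` has derivative `exp(…)·(ηea·q)` of norm `≤ |ηea|·‖q‖ ≤ |ηea|` (unitarity,
`‖q‖ ≤ 1` p. 605); mean value inequality on `[0,1]`. [cite: Balaban1982Higgs1, (1.7) p.605] -/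
theorem norm_U_sub_one_le (C : ChargeData N) (η a : ℝ) : ‖C.U η a - 1‖ ≤ |η * C.e * a| := by
  letI : NormedAlgebra ℚ (EuclideanSpace ℝ (Fin N) →L[ℝ] EuclideanSpace ℝ (Fin N)) :=
    NormedAlgebra.restrictScalars ℚ ℝ _
  set X : EuclideanSpace ℝ (Fin N) →L[ℝ] EuclideanSpace ℝ (Fin N) := (η * C.e * a) • C.q with hX
  have hU : ∀ u : ℝ, NormedSpace.exp (u • X) = C.U (u * η) a := by
    intro u
    unfold ChargeData.U
    rw [hX, smul_smul]
    congr 1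
    congr 1
    ring
  have hderiv : ∀ u : ℝ, HasDerivAt (fun u : ℝ => NormedSpace.exp (u • X)) (NormedSpace.exp (u • X) * X) u :=
    fun u => hasDerivAt_exp_smul_const X u
  have hXn : ‖X‖ ≤ |η * C.e * a| := by
    rw [hX, norm_smul, Real.norm_eq_abs]
    calc |η * C.e * a| * ‖C.q‖ ≤ |η * C.e * a| * 1 := mul_le_mul_of_nonneg_left C.norm_q_le (abs_nonneg _)
      _ = |η * C.e * a| := mul_one _
  have hbound : ∀ u ∈ Set.Ico (0 : ℝ) 1, ‖NormedSpace.exp (u • X) * X‖ ≤ |η * C.e * a| := by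
    intro u _
    calc ‖NormedSpace.exp (u • X) * X‖ ≤ ‖NormedSpace.exp (u • X)‖ * ‖X‖ := norm_mul_le _ _
      _ ≤ 1 * |η * C.e * a| := by
          refine mul_le_mul ?_ hXn (norm_nonneg _) zero_le_one
          rw [hU]
          exact opNorm_U_le_one C _ _
      _ = |η * C.e * a| := one_mul _
  have h := norm_image_sub_le_of_norm_deriv_le_segment' (f := fun u : ℝ => NormedSpace.exp (u • X))
    (fun u _ => (hderiv u).hasDerivWithinAt) hbound 1 (Set.right_mem_Icc.2 zero_le_one)
  simp only [one_smul, sub_zero, mul_one] at h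
  have e0 : NormedSpace.exp ((0 : ℝ) • X) = 1 := by
    rw [show ((0 : ℝ) • X) = 0 from zero_smul ℝ X, NormedSpace.exp_zero]
  rw [e0] at h
  have e1 : NormedSpace.exp X = C.U η a := by
    have := hU 1
    rwa [one_smul, one_mul] at this
  rw [← e1]
  exact h

/-- `‖U(η,a)w − w‖ ≤ |ηea|·‖w‖`. [cite: Balaban1982Higgs1, (1.7) p.605] -/
theorem norm_U_apply_sub_le (C : ChargeData N) (η a : ℝ) (w : EuclideanSpace ℝ (Fin N)) :
    ‖C.U η a w - w‖ ≤ |η * C.e * a| * ‖w‖ := by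
  have h : C.U η a w - w = (C.U η a - 1) w := by simp
  rw [h]
  exact (ContinuousLinearMap.le_opNorm _ _).trans (mul_le_mul_of_nonneg_right (norm_U_sub_one_le C η a) (norm_nonneg _))

/-- Composition of transports = transport by the sum (abelian structure group, p. 605). [cite: Balaban1982Higgs1, (1.7) p.605] -/
theorem U_apply_U (C : ChargeData N) (η a b : ℝ) (w : EuclideanSpace ℝ (Fin N)) :
    C.U η a (C.U η b w) = C.U η (a + b) w := by
  rw [ChargeData.U_add]; rfl

/-- **The coarse transport is the straight-path transport**: `U_{Lᵏε}(Ā⁽ᵏ⁾_{⟨y,y+e_μ⟩}) = U_ε(Ã([ỹ, ỹ + Lᵏεe_μ]))`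
(`Ā⁽ᵏ⁾ = L^{−k}Σ` of (2.55), `U_η(A) = exp(qηeA)`). [cite: Balaban1982Higgs2, (2.55) p.570] [cite: Balaban1982Higgs1, (1.7) p.605] -/
theorem U_mesh_barA {k : ℕ} (C : ChargeData N) (A : VecField P 0) (c : PBond P k) :
    C.U (P.mesh k) (barA k A c) = C.U (P.mesh 0) (segSum A (toFinest c.src) c.dir (P.L ^ k)) := by
  unfold ChargeData.U barA
  congr 1
  congr 1
  rw [mesh_eq]
  have hL : (P.L : ℝ) ^ k ≠ 0 := pow_ne_zero _ (by exact_mod_cast P.hL.ne')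
  field_simp

/-- **Covariant telescoping along a straight segment** (p. 559 of [B2] with the sum kept):
`‖U(Ã([u, u + nεe_μ]))v(u + nεe_μ) − v(u)‖ ≤ Σ_{t<n} ε‖(D^ε_Ã v)(⟨u + tεe_μ, μ⟩)‖`. [cite: Balaban1982Higgs2, (2.16) p.559]
[cite: Balaban1982Higgs1, (1.7) p.605] -/
theorem norm_U_segSum_sub_le_sum (C : ChargeData N) (A : VecField P 0) (v : ScalarField P 0 N) (u : Site P 0)
    (μ : Fin P.d) (n : ℕ) :
    ‖C.U (P.mesh 0) (segSum A u μ n) (v (shiftN u μ n)) - v u‖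
      ≤ ∑ t ∈ Finset.range n, P.mesh 0 * ‖covDeriv C A v ⟨shiftN u μ t, μ⟩‖ := by
  have h := B2LargeField.norm_transport_sub_le n (fun i => v (shiftN u μ i))
    (fun i w => C.U (P.mesh 0) (segSum A u μ i) w) (fun i => P.mesh 0 • covDeriv C A v ⟨shiftN u μ i, μ⟩)
    (fun w => by simp [segSum, ChargeData.U_zero])
    (fun i w w' => by rw [← map_sub, norm_U_apply])
    (fun i => by
      rw [segSum_succ, ← U_apply_U]
      unfold covDeriv
      rw [smul_smul, mul_inv_cancel₀ (P.mesh_pos 0).ne', one_smul, add_sub_cancel]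
      show _ = C.U (P.mesh 0) (segSum A u μ i) (C.U (P.mesh 0) (A ⟨shiftN u μ i, μ⟩) (v ((shiftN u μ i).shift μ)))
      rw [shift_shiftN])
  rw [shiftN_zero'] at h
  refine h.trans (le_of_eq (Finset.sum_congr rfl fun i _ => ?_))
  rw [norm_smul, Real.norm_of_nonneg (P.mesh_pos 0).le]

end Transport


/-! ## §7 THE COVARIANT AVERAGING INEQUALITY, one coarse bond -/

section PerBond

variable {k : ℕ}

/-- prefactor bookkeeping: `(nε)^d (nε)⁻² n^{−2d} n^d · 2ε²n²S = 2ε^dS`. [folklore] -/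
private theorem prefactor_one {n ε S : ℝ} (hn : n ≠ 0) (hε : ε ≠ 0) (d : ℕ) :
    (n * ε) ^ d * (((n * ε)⁻¹) ^ 2 * (((n ^ d)⁻¹) ^ 2 * (n ^ d * (2 * ε ^ 2 * (n * (n * S))))))
      = 2 * (ε ^ d * S) := by
  have hnd : n ^ d ≠ 0 := pow_ne_zero _ hn
  rw [mul_pow, inv_pow, inv_pow, mul_pow]
  field_simp

/-- prefactor bookkeeping: `(nε)^d (nε)⁻² n^{−2d} n^d · 2ε²e²H²S = 2e²(H/n)²·ε^dS`. [folklore] -/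
private theorem prefactor_two {n ε e H S : ℝ} (hn : n ≠ 0) (hε : ε ≠ 0) (d : ℕ) :
    (n * ε) ^ d * (((n * ε)⁻¹) ^ 2 * (((n ^ d)⁻¹) ^ 2 * (n ^ d * (2 * ε ^ 2 * (e ^ 2 * H ^ 2 * S)))))
      = 2 * e ^ 2 * (H / n) ^ 2 * (ε ^ d * S) := by
  have hnd : n ^ d ≠ 0 := pow_ne_zero _ hn
  rw [mul_pow, inv_pow, inv_pow, mul_pow, div_pow]
  field_simp

/-- `|u + v|² ≤ 2|u|² + 2|v|²`, real numbers. [folklore] -/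
private theorem add_sq_le' (a b : ℝ) : (a + b) ^ 2 ≤ 2 * a ^ 2 + 2 * b ^ 2 := by nlinarith [sq_nonneg (a - b)]

/-- **The per-site transport identity** behind (4.7)–(4.11) of [B4], exact and to all orders: for `x ∈ Bᵏ(y)`,
`x′ = x + Lᵏεe_μ`, with `S` = Ã along the straight coarse bond, `Γ, Γ′` the composite contours of `x, x′`, `P` = Ã along
`[x, x′]` and `hol = S + Γ′ − Γ − P`:
`U(S)U(Γ′)v(x′) − U(Γ)v(x) = U(Γ)[(U(P)v(x′) − v(x)) + U(P)(U(hol)v(x′) − v(x′))]`. [cite: Balaban1983RegularityDecay, §4 pp.590–591]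
[cite: Balaban1982Higgs1, (1.7) p.605] -/
theorem transport_identity (C : ChargeData N) (η S Γ' Γ Px : ℝ) (vx vx' : EuclideanSpace ℝ (Fin N)) :
    C.U η S (C.U η Γ' vx') - C.U η Γ vx
      = C.U η Γ ((C.U η Px vx' - vx) + C.U η Px (C.U η (S + Γ' - Γ - Px) vx' - vx')) := by
  simp only [map_add, map_sub, U_apply_U]
  have e : Γ + (Px + (S + Γ' - Γ - Px)) = S + Γ' := by ring
  rw [e]
  abel

/-- **THE COVARIANT AVERAGING INEQUALITY FOR ONE COARSE BOND** `c = ⟨y, y + e_μ⟩` at level `k ≤ K`, regular `Ã ≠ 0`: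
with `W = Q_k(Ã)v` and the coarse covariant derivative taken with the bond average `Ā⁽ᵏ⁾` of (II.2.55),
`(Lᵏε)^d |(D^{Lᵏε}_{Ā⁽ᵏ⁾} W)(c)|² ≤ 2 Σ_b ε^d|(D^ε_Ã v)(b)|² + 8d² e² L^{2k} δ² Σ_{x′∈Bᵏ(y+e_μ)} ε^d|v(x′)|²`,
the first sum over the fine bonds `b` of direction `μ` whose endpoints have k-block points in `{y, y + e_μ}`, provided
`|Ã(⟨z + εe_ν, ·⟩_{μ′}) − Ã(⟨z, ·⟩_{μ′})| ≤ δ` at every `z ∈ Bᵏ(y) ∪ Bᵏ(y + e_μ)` ((1.21) of [B4] in lattice units).  Route: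
telescoping along the `L^{kd}` straight paths with the transports (exact), the prism holonomy per path bounded by
`abs_hol_le`, Cauchy–Schwarz, each fine bond met by `≤ Lᵏ` (point, step) pairs — the recorded deviation of `B4Prop31Regular`
from the printed (4.5)–(4.22), re-run on the torus. [cite: Balaban1983RegularityDecay, (1.22) p.574; §4 pp.589–591]
[cite: Balaban1982Higgs2, (3.29) p.590] -/
theorem covDeriv_avgQk_sq_le (hk : k ≤ P.K) (C : ChargeData N) (A : VecField P 0) (v : ScalarField P 0 N)
    (y : Site P k) (μ : Fin P.d) {δ : ℝ} (hδ : 0 ≤ δ)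
    (hreg : ∀ z : Site P 0, (blockIter k z = y ∨ blockIter k z = y.shift μ) →
      ∀ μ' ν : Fin P.d, |A ⟨z.shift ν, μ'⟩ - A ⟨z, μ'⟩| ≤ δ) :
    P.mesh k ^ P.d * ‖covDeriv C (barA k A) (avgQk C A k v) ⟨y, μ⟩‖ ^ 2
      ≤ 2 * (∑ b : PBond P 0,
          if b.dir = μ ∧ (blockIter k b.src = y ∨ blockIter k b.src = y.shift μ)
              ∧ (blockIter k b.tgt = y ∨ blockIter k b.tgt = y.shift μ)
          then P.mesh 0 ^ P.d * ‖covDeriv C A v b‖ ^ 2 else 0)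
        + 8 * (P.d : ℝ) ^ 2 * C.e ^ 2 * ((P.L : ℝ) ^ k) ^ 2 * δ ^ 2 *
          ∑ x' ∈ blockK k (y.shift μ), P.mesh 0 ^ P.d * ‖v x'‖ ^ 2 := by
  classical
  set n : ℕ := P.L ^ k with hn_def
  set Nn : ℝ := (P.L : ℝ) ^ (k * P.d) with hNn_def
  set S := blockK k y ×ˢ range n with hS_def
  set ε := P.mesh 0 with hε
  set W := avgQk C A k v with hW
  set Sc : ℝ := segSum A (toFinest y) μ n with hSc
  set Γ : Site P 0 → ℝ := fun x => multiContourSum A k x with hΓ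
  set Px : Site P 0 → ℝ := fun x => segSum A x μ n with hPx
  set hol : Site P 0 → ℝ := fun x => Sc + Γ (shiftN x μ n) - Γ x - Px x with hhol
  set H : ℝ := 2 * P.d * ((P.L : ℝ) ^ k) ^ 2 * δ with hH
  have hNn : 0 < Nn := pow_pos (by exact_mod_cast P.hL) _
  have hε0 : 0 < ε := P.mesh_pos 0
  have hmk : 0 < P.mesh k := P.mesh_pos k
  have hn0 : (0 : ℝ) < n := by rw [hn_def]; exact_mod_cast pow_pos P.hL k
  have hNn_eq : Nn = (n : ℝ) ^ P.d := by rw [hNn_def, hn_def, cast_pow_kd]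
  have hmesh : P.mesh k = n * ε := by rw [hε, mesh_eq, hn_def]; push_cast; rfl
  have hcardB : ((blockK k y).card : ℝ) = Nn := by rw [card_blockK hk, hNn_def]; push_cast; rfl
  have hcardS : (S.card : ℝ) = Nn * n := by
    rw [hS_def, Finset.card_product, card_blockK hk, Finset.card_range, hn_def, hNn_def]; push_cast; rfl
  have hH0 : 0 ≤ H := by rw [hH]; positivity
  -- the holonomy bound per straight path
  have hhol : ∀ x ∈ blockK k y, |hol x| ≤ H := fun x hx => by
    rw [hhol, hH, hSc, hΓ, hPx]
    exact abs_hol_le hk A y μ hx hδ hreg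
  -- Step a/b/c: the numerator of the coarse covariant derivative as an average of per-site terms
  have hWy' : W (y.shift μ) = Nn⁻¹ • ∑ x ∈ blockK k y,
      C.U ε (Γ (shiftN x μ n)) (v (shiftN x μ n)) := by
    rw [hW, avgQk_apply, ← image_shiftN_blockK hk y μ, Finset.sum_image ((shiftN_injective μ (P.L ^ k)).injOn)]
  have hWy : W y = Nn⁻¹ • ∑ x ∈ blockK k y, C.U ε (Γ x) (v x) := by rw [hW, avgQk_apply]
  have hnum : C.U (P.mesh k) (barA k A ⟨y, μ⟩) (W (y.shift μ)) - W y
      = Nn⁻¹ • ∑ x ∈ blockK k y,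
          C.U ε (Γ x) ((C.U ε (Px x) (v (shiftN x μ n)) - v x)
            + C.U ε (Px x) (C.U ε (hol x) (v (shiftN x μ n)) - v (shiftN x μ n))) := by
    rw [U_mesh_barA, hWy', hWy, map_smul, map_sum, ← smul_sub, ← Finset.sum_sub_distrib]
    congr 1
    refine Finset.sum_congr rfl fun x _ => ?_
    exact transport_identity C ε Sc (Γ (shiftN x μ n)) (Γ x) (Px x) (v x) (v (shiftN x μ n))
  -- Step e: norms of the per-site terms
  set a : Site P 0 → ℝ := fun x => ∑ t ∈ range n, ε * ‖covDeriv C A v ⟨shiftN x μ t, μ⟩‖ with ha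
  set b : Site P 0 → ℝ := fun x => ε * |C.e| * H * ‖v (shiftN x μ n)‖ with hb
  have ha0 : ∀ x, 0 ≤ a x := fun x => Finset.sum_nonneg fun t _ => by positivity
  have hb0 : ∀ x, 0 ≤ b x := fun x => by rw [hb]; positivity
  have hterm : ∀ x ∈ blockK k y, ‖C.U ε (Γ x) ((C.U ε (Px x) (v (shiftN x μ n)) - v x)
      + C.U ε (Px x) (C.U ε (hol x) (v (shiftN x μ n)) - v (shiftN x μ n)))‖ ≤ a x + b x := by
    intro x hx
    rw [norm_U_apply]
    refine (norm_add_le _ _).trans (add_le_add ?_ ?_)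
    · exact norm_U_segSum_sub_le_sum C A v x μ n
    · rw [norm_U_apply]
      refine (norm_U_apply_sub_le C ε (hol x) _).trans ?_
      rw [hb, abs_mul, abs_mul, abs_of_pos hε0]
      exact mul_le_mul_of_nonneg_right (mul_le_mul_of_nonneg_left (hhol x hx) (by positivity)) (norm_nonneg _)
  have hnum_le : ‖C.U (P.mesh k) (barA k A ⟨y, μ⟩) (W (y.shift μ)) - W y‖
      ≤ Nn⁻¹ * ∑ x ∈ blockK k y, (a x + b x) := by
    rw [hnum, norm_smul, Real.norm_of_nonneg (inv_nonneg.2 hNn.le)]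
    exact mul_le_mul_of_nonneg_left ((norm_sum_le _ _).trans (Finset.sum_le_sum hterm)) (inv_nonneg.2 hNn.le)
  -- Step f: Cauchy–Schwarz twice
  have hCS1 : (∑ x ∈ blockK k y, (a x + b x)) ^ 2
      ≤ Nn * ∑ x ∈ blockK k y, (2 * (a x) ^ 2 + 2 * (b x) ^ 2) := by
    calc (∑ x ∈ blockK k y, (a x + b x)) ^ 2 ≤ (blockK k y).card * ∑ x ∈ blockK k y, (a x + b x) ^ 2 :=
          sq_sum_le_card_mul_sum_sq
      _ ≤ Nn * ∑ x ∈ blockK k y, (2 * (a x) ^ 2 + 2 * (b x) ^ 2) := by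
          rw [hcardB]
          exact mul_le_mul_of_nonneg_left (Finset.sum_le_sum fun x _ => add_sq_le' _ _) hNn.le
  have hCSa : ∀ x, (a x) ^ 2 ≤ ε ^ 2 * (n * ∑ t ∈ range n, ‖covDeriv C A v ⟨shiftN x μ t, μ⟩‖ ^ 2) := by
    intro x
    rw [ha]
    simp only [← Finset.mul_sum]
    rw [mul_pow]
    refine mul_le_mul_of_nonneg_left ?_ (sq_nonneg _)
    calc (∑ t ∈ range n, ‖covDeriv C A v ⟨shiftN x μ t, μ⟩‖) ^ 2
        ≤ (range n).card * ∑ t ∈ range n, ‖covDeriv C A v ⟨shiftN x μ t, μ⟩‖ ^ 2 := sq_sum_le_card_mul_sum_sq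
      _ = n * ∑ t ∈ range n, ‖covDeriv C A v ⟨shiftN x μ t, μ⟩‖ ^ 2 := by rw [Finset.card_range]
  have hbsq : ∀ x, (b x) ^ 2 = ε ^ 2 * (C.e ^ 2 * H ^ 2 * ‖v (shiftN x μ n)‖ ^ 2) := by
    intro x; rw [hb]; rw [show (ε * |C.e| * H * ‖v (shiftN x μ n)‖) ^ 2
      = ε ^ 2 * (|C.e| ^ 2 * H ^ 2 * ‖v (shiftN x μ n)‖ ^ 2) by ring, sq_abs]
  -- the sum over (point, step) pairs and its multiplicity
  have hpairs : ∑ x ∈ blockK k y, ∑ t ∈ range n, ‖covDeriv C A v ⟨shiftN x μ t, μ⟩‖ ^ 2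
      = ∑ p ∈ S, ‖covDeriv C A v ⟨shiftN p.1 μ p.2, μ⟩‖ ^ 2 := by
    rw [hS_def, Finset.sum_product]
  have hmult : ∑ p ∈ S, ‖covDeriv C A v ⟨shiftN p.1 μ p.2, μ⟩‖ ^ 2
      ≤ n * ∑ z ∈ S.image (fun p => shiftN p.1 μ p.2), ‖covDeriv C A v ⟨z, μ⟩‖ ^ 2 := by
    rw [Finset.sum_comp (fun z => ‖covDeriv C A v (⟨z, μ⟩ : PBond P 0)‖ ^ 2)
      (fun p : Site P 0 × ℕ => shiftN p.1 μ p.2), Finset.mul_sum]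
    refine Finset.sum_le_sum fun z _ => ?_
    rw [nsmul_eq_mul]
    have hc : (((S.filter fun p => shiftN p.1 μ p.2 = z)).card : ℝ) ≤ n := by
      rw [hn_def]; exact_mod_cast card_fiber_le y μ z
    exact mul_le_mul_of_nonneg_right hc (sq_nonneg _)
  have himg : ∑ z ∈ S.image (fun p => shiftN p.1 μ p.2), P.mesh 0 ^ P.d * ‖covDeriv C A v ⟨z, μ⟩‖ ^ 2
      ≤ ∑ b : PBond P 0,
          if b.dir = μ ∧ (blockIter k b.src = y ∨ blockIter k b.src = y.shift μ)
              ∧ (blockIter k b.tgt = y ∨ blockIter k b.tgt = y.shift μ)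
          then P.mesh 0 ^ P.d * ‖covDeriv C A v b‖ ^ 2 else 0 := by
    have hinj : Set.InjOn (fun z : Site P 0 => (⟨z, μ⟩ : PBond P 0)) ↑(S.image (fun p => shiftN p.1 μ p.2)) := by
      intro z _ z' _ h
      cases h
      rfl
    rw [show ∑ z ∈ S.image (fun p => shiftN p.1 μ p.2), P.mesh 0 ^ P.d * ‖covDeriv C A v ⟨z, μ⟩‖ ^ 2
      = ∑ b ∈ (S.image (fun p => shiftN p.1 μ p.2)).image (fun z => (⟨z, μ⟩ : PBond P 0)),
          P.mesh 0 ^ P.d * ‖covDeriv C A v b‖ ^ 2 by rw [Finset.sum_image hinj], ← Finset.sum_filter]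
    refine Finset.sum_le_sum_of_subset_of_nonneg (fun b hb => ?_) (fun b _ _ => by positivity)
    rw [Finset.mem_image] at hb
    obtain ⟨z, hz, rfl⟩ := hb
    rw [Finset.mem_image] at hz
    obtain ⟨p, hp, rfl⟩ := hz
    rw [hS_def, Finset.mem_product, mem_blockK, Finset.mem_range] at hp
    rw [Finset.mem_filter]
    refine ⟨Finset.mem_univ _, rfl, ?_, ?_⟩
    · have h := blockIter_shiftN_of_le hk p.1 μ (le_of_lt hp.2)
      rw [hp.1] at h
      exact h
    · have h := blockIter_shiftN_of_le hk p.1 μ (Nat.succ_le_of_lt hp.2)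
      rw [hp.1] at h
      show blockIter k ((shiftN p.1 μ p.2).shift μ) = y ∨ blockIter k ((shiftN p.1 μ p.2).shift μ) = y.shift μ
      rw [shift_shiftN]
      exact h
  -- the zero-order sum reindexed onto `Bᵏ(y + e_μ)`
  have hvsum : ∑ x ∈ blockK k y, ‖v (shiftN x μ n)‖ ^ 2 = ∑ x' ∈ blockK k (y.shift μ), ‖v x'‖ ^ 2 := by
    rw [← image_shiftN_blockK hk y μ, Finset.sum_image ((shiftN_injective μ (P.L ^ k)).injOn)]
  -- assemble
  have hD : covDeriv C (barA k A) W ⟨y, μ⟩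
      = (P.mesh k)⁻¹ • (C.U (P.mesh k) (barA k A ⟨y, μ⟩) (W (y.shift μ)) - W y) := by
    simp only [HiggsLattice.covDeriv, PBond.tgt]
  set S1 := ∑ z ∈ S.image (fun p => shiftN p.1 μ p.2), ‖covDeriv C A v ⟨z, μ⟩‖ ^ 2 with hS1
  set S2 := ∑ x' ∈ blockK k (y.shift μ), ‖v x'‖ ^ 2 with hS2
  have hS1_0 : 0 ≤ S1 := Finset.sum_nonneg fun _ _ => sq_nonneg _
  have hS2_0 : 0 ≤ S2 := Finset.sum_nonneg fun _ _ => sq_nonneg _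
  have hsumsq : ∑ x ∈ blockK k y, (2 * (a x) ^ 2 + 2 * (b x) ^ 2)
      ≤ 2 * ε ^ 2 * (n * (n * S1)) + 2 * ε ^ 2 * (C.e ^ 2 * H ^ 2 * S2) := by
    have h1 : ∑ x ∈ blockK k y, (a x) ^ 2 ≤ ε ^ 2 * (n * (n * S1)) := by
      calc ∑ x ∈ blockK k y, (a x) ^ 2
          ≤ ∑ x ∈ blockK k y, ε ^ 2 * (n * ∑ t ∈ range n, ‖covDeriv C A v ⟨shiftN x μ t, μ⟩‖ ^ 2) :=
            Finset.sum_le_sum fun x _ => hCSa x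
        _ = ε ^ 2 * (n * ∑ p ∈ S, ‖covDeriv C A v ⟨shiftN p.1 μ p.2, μ⟩‖ ^ 2) := by
            rw [← Finset.mul_sum, ← Finset.mul_sum, hpairs]
        _ ≤ ε ^ 2 * (n * (n * S1)) := by
            refine mul_le_mul_of_nonneg_left (mul_le_mul_of_nonneg_left hmult hn0.le) (sq_nonneg _)
    have h2 : ∑ x ∈ blockK k y, (b x) ^ 2 = ε ^ 2 * (C.e ^ 2 * H ^ 2 * S2) := by
      rw [Finset.sum_congr rfl fun x _ => hbsq x, ← Finset.mul_sum, ← Finset.mul_sum, hvsum]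
    rw [Finset.sum_add_distrib, ← Finset.mul_sum, ← Finset.mul_sum, h2]
    linarith
  have hnorm_sq : ‖covDeriv C (barA k A) W ⟨y, μ⟩‖ ^ 2
      ≤ (P.mesh k)⁻¹ ^ 2 * (Nn⁻¹ ^ 2 * (Nn * (2 * ε ^ 2 * (n * (n * S1)) + 2 * ε ^ 2 * (C.e ^ 2 * H ^ 2 * S2)))) := by
    rw [hD, norm_smul, mul_pow, Real.norm_of_nonneg (inv_nonneg.2 hmk.le)]
    refine mul_le_mul_of_nonneg_left ?_ (sq_nonneg _)
    calc ‖C.U (P.mesh k) (barA k A ⟨y, μ⟩) (W (y.shift μ)) - W y‖ ^ 2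
        ≤ (Nn⁻¹ * ∑ x ∈ blockK k y, (a x + b x)) ^ 2 := by
          gcongr
      _ = Nn⁻¹ ^ 2 * (∑ x ∈ blockK k y, (a x + b x)) ^ 2 := by ring
      _ ≤ Nn⁻¹ ^ 2 * (Nn * (2 * ε ^ 2 * (n * (n * S1)) + 2 * ε ^ 2 * (C.e ^ 2 * H ^ 2 * S2))) := by
          refine mul_le_mul_of_nonneg_left (hCS1.trans ?_) (sq_nonneg _)
          exact mul_le_mul_of_nonneg_left hsumsq hNn.le
  -- the prefactor algebra: `(Lᵏε)^d (Lᵏε)⁻² Nn⁻¹ · 2ε²n² S1 = 2 ε^d S1`, `… 2ε² e²H² S2 = 8d²e²L^{2k}δ² ε^d S2`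
  have hgoal1 : P.mesh k ^ P.d * ((P.mesh k)⁻¹ ^ 2 * (Nn⁻¹ ^ 2 * (Nn * (2 * ε ^ 2 * (n * (n * S1))))))
      = 2 * (ε ^ P.d * S1) := by
    rw [hmesh, hNn_eq]
    exact prefactor_one hn0.ne' hε0.ne' P.d
  have hgoal2 : P.mesh k ^ P.d * ((P.mesh k)⁻¹ ^ 2 * (Nn⁻¹ ^ 2 * (Nn * (2 * ε ^ 2 * (C.e ^ 2 * H ^ 2 * S2)))))
      = 8 * (P.d : ℝ) ^ 2 * C.e ^ 2 * ((P.L : ℝ) ^ k) ^ 2 * δ ^ 2 * (ε ^ P.d * S2) := by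
    rw [hmesh, hNn_eq, prefactor_two hn0.ne' hε0.ne' P.d, hH]
    have hn' : (n : ℝ) = (P.L : ℝ) ^ k := by rw [hn_def]; push_cast; rfl
    rw [← hn']
    field_simp
    ring
  calc P.mesh k ^ P.d * ‖covDeriv C (barA k A) W ⟨y, μ⟩‖ ^ 2
      ≤ P.mesh k ^ P.d * ((P.mesh k)⁻¹ ^ 2 * (Nn⁻¹ ^ 2 * (Nn * (2 * ε ^ 2 * (n * (n * S1))
          + 2 * ε ^ 2 * (C.e ^ 2 * H ^ 2 * S2))))) := mul_le_mul_of_nonneg_left hnorm_sq (pow_nonneg hmk.le _)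
    _ = 2 * (ε ^ P.d * S1) + 8 * (P.d : ℝ) ^ 2 * C.e ^ 2 * ((P.L : ℝ) ^ k) ^ 2 * δ ^ 2 * (ε ^ P.d * S2) := by
        rw [← hgoal1, ← hgoal2]; ring
    _ ≤ _ := by
        rw [hS1, hS2]
        refine add_le_add ?_ (le_of_eq ?_)
        · rw [Finset.mul_sum]; exact mul_le_mul_of_nonneg_left himg (by norm_num)
        · rw [Finset.mul_sum]

end PerBond


/-! ## §8 THE COVARIANT AVERAGING INEQUALITY for a region `Λ ⊂ T⁽ᵏ⁾`, `Ω = Bᵏ(Λ)` -/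

section Region

variable {k : ℕ}

/-- **Each coarse site is the endpoint of `d` coarse bonds**: `Σ_{c⊂Λ} G(c₊) ≤ d·Σ_{y∈Λ} G(y)` for `G ≥ 0`.
[folklore] [cite: Balaban1983RegularityDecay, (1.22) p.574] -/
theorem sum_inside_tgt_le (Λ : Finset (Site P k)) (G : Site P k → ℝ) (hG : ∀ y, 0 ≤ G y) :
    (∑ c : PBond P k, if Inside Λ c then G c.tgt else 0) ≤ P.d * ∑ y ∈ Λ, G y := by
  classical
  calc (∑ c : PBond P k, if Inside Λ c then G c.tgt else 0)
      ≤ ∑ c : PBond P k, if c.tgt ∈ Λ then G c.tgt else 0 := Finset.sum_le_sum fun c _ => by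
        by_cases h : Inside Λ c
        · rw [if_pos h, if_pos h.2]
        · rw [if_neg h]; split_ifs <;> simp [hG]
    _ = ∑ x : Site P k, ∑ μ : Fin P.d, if x.shift μ ∈ Λ then G (x.shift μ) else 0 :=
        (sum_site_dir (fun x μ => if x.shift μ ∈ Λ then G (x.shift μ) else 0)).symm
    _ = ∑ μ : Fin P.d, ∑ x : Site P k, if x.shift μ ∈ Λ then G (x.shift μ) else 0 := Finset.sum_comm
    _ = ∑ _μ : Fin P.d, ∑ y ∈ Λ, G y := by
        refine Finset.sum_congr rfl fun μ _ => ?_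
        rw [show (∑ x : Site P k, if x.shift μ ∈ Λ then G (x.shift μ) else 0)
          = ∑ y : Site P k, if y ∈ Λ then G y else 0 from
          Equiv.sum_comp (shiftEquiv P k μ) (fun y => if y ∈ Λ then G y else 0), ← Finset.sum_filter]
        simp
    _ = P.d * ∑ y ∈ Λ, G y := by rw [Finset.sum_const, Finset.card_univ, Fintype.card_fin, nsmul_eq_mul]

/-- `Σ_{y∈Λ} Σ_{x∈Bᵏ(y)} F(x) = Σ_{x∈Bᵏ(Λ)} F(x)`. [cite: Balaban1982Higgs1, (1.20) p.607] -/
theorem sum_blockK_sum (Λ : Finset (Site P k)) (Ω : Finset (Site P 0)) (hΩ : ∀ x, x ∈ Ω ↔ blockIter k x ∈ Λ)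
    (F : Site P 0 → ℝ) : ∑ y ∈ Λ, ∑ x ∈ blockK k y, F x = ∑ x ∈ Ω, F x := by
  classical
  have hmaps : ∀ x ∈ Ω, blockIter k x ∈ Λ := fun x hx => (hΩ x).1 hx
  rw [← Finset.sum_fiberwise_of_maps_to hmaps]
  refine Finset.sum_congr rfl fun y hy => ?_
  have hfib : Ω.filter (fun x => blockIter k x = y) = blockK k y := by
    ext x
    rw [Finset.mem_filter, mem_blockK]
    exact ⟨fun h => h.2, fun h => ⟨(hΩ x).2 (h ▸ hy), h⟩⟩
  rw [hfib]

/-- **THE COVARIANT AVERAGING INEQUALITY** for a region `Λ ⊂ T⁽ᵏ⁾` and `Ω = Bᵏ(Λ) ⊂ T_ε` (`k ≤ K`, any `v : T_ε → ℝ^N`),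
regular `Ã ≠ 0` — `|Ã(⟨z + εe_ν,·⟩) − Ã(⟨z,·⟩)| ≤ δ` componentwise at every `z ∈ Ω` ((1.21) of [B4] in lattice units):
`Σ_{⟨y,y′⟩⊂Λ} (Lᵏε)^d |(D^{Lᵏε}_{Ā⁽ᵏ⁾} Q_k(Ã)v)(⟨y,y′⟩)|² ≤ 4 Σ_{b⊂Ω} ε^d |(D^ε_Ã v)(b)|² + 8d³e²L^{2k}δ² Σ_{x∈Ω} ε^d|v(x)|²`, i.e.
with the printed weights `Σ_{⟨y,y′⟩⊂Λ}(Lᵏε)^{d−2}|U(Ã(⟨y,y′⟩))(Q_k(Ã)v)(y′) − (Q_k(Ã)v)(y)|² ≤ 4Σ_{⟨x,x′⟩⊂Ω}ε^{d−2}|U(Ã_{⟨x,x′⟩})v(x′) − v(x)|²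
+ (holonomy error)` (each fine bond serves at most two coarse bonds; each coarse site ends `d` coarse bonds).  At `Ã = 0` this
is p15's `B2Ineq329ZeroAveraging.averaging_ineq` (there with the constant 2 and no error term). [cite: Balaban1983RegularityDecay, (1.22) p.574; §4 pp.589–591]
[cite: Balaban1982Higgs2, (3.29) p.590] -/
theorem cov_averaging_ineq (hk : k ≤ P.K) (C : ChargeData N) (A : VecField P 0) (Λ : Finset (Site P k))
    (Ω : Finset (Site P 0)) (hΩ : ∀ x, x ∈ Ω ↔ blockIter k x ∈ Λ) {δ : ℝ} (hδ : 0 ≤ δ)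
    (hreg : ∀ z ∈ Ω, ∀ μ' ν : Fin P.d, |A ⟨z.shift ν, μ'⟩ - A ⟨z, μ'⟩| ≤ δ) (v : ScalarField P 0 N) :
    (∑ c : PBond P k, if Inside Λ c then
        P.mesh k ^ P.d * ‖covDeriv C (barA k A) (avgQk C A k v) c‖ ^ 2 else 0)
      ≤ 4 * (∑ b : PBond P 0, if Inside Ω b then P.mesh 0 ^ P.d * ‖covDeriv C A v b‖ ^ 2 else 0)
        + 8 * (P.d : ℝ) ^ 3 * C.e ^ 2 * ((P.L : ℝ) ^ k) ^ 2 * δ ^ 2 * ∑ x ∈ Ω, P.mesh 0 ^ P.d * ‖v x‖ ^ 2 := by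
  classical
  set κ : ℝ := 8 * (P.d : ℝ) ^ 2 * C.e ^ 2 * ((P.L : ℝ) ^ k) ^ 2 * δ ^ 2 with hκ
  have hκ0 : 0 ≤ κ := by rw [hκ]; positivity
  have hm0 : 0 ≤ P.mesh 0 ^ P.d := pow_nonneg (P.mesh_pos 0).le _
  have hG0 : ∀ b : PBond P 0, 0 ≤ P.mesh 0 ^ P.d * ‖covDeriv C A v b‖ ^ 2 := fun b => mul_nonneg hm0 (sq_nonneg _)
  set G : Site P k → ℝ := fun y' => ∑ x' ∈ blockK k y', P.mesh 0 ^ P.d * ‖v x'‖ ^ 2 with hG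
  have hG0' : ∀ y', 0 ≤ G y' := fun y' => Finset.sum_nonneg fun _ _ => mul_nonneg hm0 (sq_nonneg _)
  -- per coarse bond
  have hper : ∀ c : PBond P k, Inside Λ c →
      P.mesh k ^ P.d * ‖covDeriv C (barA k A) (avgQk C A k v) c‖ ^ 2
        ≤ 2 * (∑ b : PBond P 0,
            if b.dir = c.dir ∧ (blockIter k b.src = c.src ∨ blockIter k b.src = c.src.shift c.dir)
                ∧ (blockIter k b.tgt = c.src ∨ blockIter k b.tgt = c.src.shift c.dir)
            then P.mesh 0 ^ P.d * ‖covDeriv C A v b‖ ^ 2 else 0) + κ * G c.tgt := by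
    rintro ⟨y, μ⟩ hc
    refine covDeriv_avgQk_sq_le hk C A v y μ hδ fun z hz μ' ν => hreg z ?_ μ' ν
    rw [hΩ]
    rcases hz with h | h
    · rw [h]; exact hc.1
    · rw [h]; exact hc.2
  calc (∑ c : PBond P k, if Inside Λ c then P.mesh k ^ P.d * ‖covDeriv C (barA k A) (avgQk C A k v) c‖ ^ 2 else 0)
      ≤ ∑ c : PBond P k, ((∑ b : PBond P 0,
          if Inside Λ c ∧ (b.dir = c.dir ∧ (blockIter k b.src = c.src ∨ blockIter k b.src = c.src.shift c.dir)
            ∧ (blockIter k b.tgt = c.src ∨ blockIter k b.tgt = c.src.shift c.dir))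
          then 2 * (P.mesh 0 ^ P.d * ‖covDeriv C A v b‖ ^ 2) else 0)
          + (if Inside Λ c then κ * G c.tgt else 0)) := by
        refine Finset.sum_le_sum fun c _ => ?_
        by_cases hc : Inside Λ c
        · rw [if_pos hc, if_pos hc]
          refine (hper c hc).trans (le_of_eq ?_)
          rw [Finset.mul_sum]
          congr 1
          refine Finset.sum_congr rfl fun b _ => ?_
          by_cases hb : b.dir = c.dir ∧ (blockIter k b.src = c.src ∨ blockIter k b.src = c.src.shift c.dir)
              ∧ (blockIter k b.tgt = c.src ∨ blockIter k b.tgt = c.src.shift c.dir)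
          · rw [if_pos hb, if_pos ⟨hc, hb⟩]
          · rw [if_neg hb, if_neg (fun h => hb h.2), mul_zero]
        · rw [if_neg hc, if_neg hc, add_zero]
          refine Finset.sum_nonneg fun b _ => ?_
          rw [if_neg (fun h => hc h.1)]
    _ = (∑ b : PBond P 0, ∑ c : PBond P k,
          if Inside Λ c ∧ (b.dir = c.dir ∧ (blockIter k b.src = c.src ∨ blockIter k b.src = c.src.shift c.dir)
            ∧ (blockIter k b.tgt = c.src ∨ blockIter k b.tgt = c.src.shift c.dir))
          then 2 * (P.mesh 0 ^ P.d * ‖covDeriv C A v b‖ ^ 2) else 0)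
        + ∑ c : PBond P k, (if Inside Λ c then κ * G c.tgt else 0) := by
        rw [Finset.sum_add_distrib, Finset.sum_comm]
    _ ≤ (∑ b : PBond P 0, 2 * (if Inside Ω b then 2 * (P.mesh 0 ^ P.d * ‖covDeriv C A v b‖ ^ 2) else 0))
        + P.d * ∑ y ∈ Λ, κ * G y := by
        refine add_le_add (Finset.sum_le_sum fun b _ => coarse_count_le Λ Ω hΩ b _ (by linarith [hG0 b])) ?_
        exact sum_inside_tgt_le Λ (fun y => κ * G y) fun y => mul_nonneg hκ0 (hG0' y)
    _ = 4 * (∑ b : PBond P 0, if Inside Ω b then P.mesh 0 ^ P.d * ‖covDeriv C A v b‖ ^ 2 else 0)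
        + 8 * (P.d : ℝ) ^ 3 * C.e ^ 2 * ((P.L : ℝ) ^ k) ^ 2 * δ ^ 2 * ∑ x ∈ Ω, P.mesh 0 ^ P.d * ‖v x‖ ^ 2 := by
        have e1 : ∑ y ∈ Λ, κ * G y = κ * ∑ x ∈ Ω, P.mesh 0 ^ P.d * ‖v x‖ ^ 2 := by
          rw [← Finset.mul_sum, ← sum_blockK_sum Λ Ω hΩ]
        have e2 : (∑ b : PBond P 0, 2 * (if Inside Ω b then 2 * (P.mesh 0 ^ P.d * ‖covDeriv C A v b‖ ^ 2) else 0))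
            = 4 * ∑ b : PBond P 0, (if Inside Ω b then P.mesh 0 ^ P.d * ‖covDeriv C A v b‖ ^ 2 else 0) := by
          rw [Finset.mul_sum]
          refine Finset.sum_congr rfl fun b _ => ?_
          split_ifs <;> ring
        rw [e1, e2, hκ]
        ring

end Region

end Literature.MathematicalPhysics.QuantumFieldTheory.Balaban1983to89.B2Ineq329CovariantAveraging
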